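import Literature.NumberTheory.Automorphic.HarishChandraGLEmbeddings
import Literature.NumberTheory.Automorphic.HarishChandraGLProjection
import Literature.NumberTheory.Automorphic.HighestWeightGL
import HarnessLib

/-!
# Highest weight calculus for factorwise representations of `𝔤𝔩ₙ(𝕜)_ℂ = ∏_τ 𝔤𝔩ₙ(ℂ)`

Topic `Literature/NumberTheory/Automorphic` (support for `HarishChandraGL.lean`: the proof of the
named fact `Literature.NumberTheory.Automorphic.nonempty_harishChandraHomGL`, assembled in `HarishChandraGLExistence`).

Let `𝕜` be `ℝ` or `ℂ`, `T = (𝕜 →ₐ[ℝ] ℂ)`, `𝔤 = 𝔤𝔩ₙ(𝕜)` (real Lie algebra) and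
`𝔤_ℂ = 𝔤 ⊗_ℝ ℂ = ∏_{τ ∈ T} 𝔤𝔩ₙ(ℂ)` (Knapp, *Lie Groups Beyond an Introduction*, §VI.1). A complex
representation of `𝔤_ℂ` on `V` is the same as a family of complex Lie algebra homomorphisms
`Ψ_τ : 𝔤𝔩ₙ(ℂ) → End_ℂ V` with pairwise commuting images (`FactorRep`); its restriction to the
real form `𝔤 ↪ 𝔤_ℂ`, `X ↦ (τ(X))_τ`, is the real Lie algebra homomorphism
`FactorRep.rho Ψ : 𝔤 →ₗ⁅ℝ⁆ End_ℂ V`, `X ↦ ∑_τ Ψ_τ(τ(X))`. Conversely `Ψ_τ(τ X)` is recovered from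
`ρ = FactorRep.rho Ψ` as the `τ`-projector `HCEmb.proj ρ τ X` (`proj_rho`).

For such representations this file carries out the `𝔰𝔩₂`-string computation behind the Weyl
group symmetry of the Harish-Chandra homomorphism (Humphreys, GTM 9, §21.2 Lemma (a)–(c) and §23.2
Proposition with its Corollary; Knapp, §V.3 and §V.5, proof of Thm. 5.44): if `v` is a highest
weight vector of weight `l` (for `ρ`, in the sense of `IsHighestWeightVector`),
`α = e_{τ,i} - e_{τ,i+1}` a simple root of the factor `τ`, `F = Ψ_τ(E_{i+1,i})` the corresponding
lowering operator and
`m = ⟨l + ρ, α^∨⟩ = l_{τ,i} - l_{τ,i+1} + 1` a natural number, then `F^m v` is annihilated by `𝔫`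
and has weight `s_α(l + ρ) - ρ`; hence it is a highest weight vector as soon as it is nonzero
(`isHighestWeightVector_pow`). Moreover `F` commutes with the action of the centre `Z(𝔤)`
(`E_lift_center`).

Relation to `HighestWeightGL` (in the tree). That file encodes a representation of `𝔤_ℂ` as ONE
complex Lie algebra homomorphism `ρC : (T → Matrix (Fin n) (Fin n) ℂ) →ₗ⁅ℂ⁆ End_ℂ V` out of the
product Lie algebra, with the highest weight predicate `IsHighestWeightVectorC ρC l v`. The two
encodings are equivalent and this file provides the bridge: `FactorRep.toLieHom`
(`X ↦ ∑_τ Ψ_τ(X_τ)`), `FactorRep.ofLieHom` (`Ψ_τ = ρC ∘ single τ`), and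
`FactorRep.isHighestWeightVectorC_iff : IsHighestWeightVectorC Ψ.toLieHom l v ↔
IsHighestWeightVector Ψ.rho l v`. The factorwise form is kept because the `𝔰𝔩₂`-string calculus
below is about the matrix units `E Ψ τ j k = Ψ_τ(E_{jk})` of one factor at a time. Note that the
models of `HighestWeightGL` (products of principal minors in a polynomial ring, highest weights
`λ` polynomial dominant) cannot feed the *existence* proof of the Harish-Chandra homomorphism:
being locally finite they have *finite* `𝔰𝔩₂`-strings, `F_α^m v = 0` for `m = ⟨λ + ρ, α^∨⟩`, whereas
the `W`-symmetry step (`isHighestWeightVector_pow` below, applied in `HarishChandraGLExistence`)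
needs a highest weight vector with `F_α^m v ≠ 0`; such vectors are supplied by the model of
`HarishChandraGLModel` (complex exponents, free lowering strings).

## Main definitions

* `Literature.Automorphic.HCWt.FactorRep 𝕜 n V` — commuting families `(Ψ_τ)_τ` of complex Lie algebra
  homomorphisms `𝔤𝔩ₙ(ℂ) → End_ℂ V`; `FactorRep.rho` — the associated real representation of
  `𝔤𝔩ₙ(𝕜)`; `FactorRep.E Ψ τ j k = Ψ_τ(E_{jk})` — the matrix units of `𝔤_ℂ` acting on `V`.
* `Literature.Automorphic.HCWt.shiftWt l τ i i' c` — the weight `l - c • (e_{τ,i} - e_{τ,i'})`.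

## Main statements

* `FactorRep.toLieHom`, `FactorRep.ofLieHom`, `FactorRep.isHighestWeightVectorC_iff` — the
  bridge to the encoding `(T → 𝔤𝔩ₙ(ℂ)) →ₗ⁅ℂ⁆ End_ℂ V` and `IsHighestWeightVectorC` of
  `HighestWeightGL`.
* `FactorRep.proj_rho` — `proj ρ τ X = Ψ_τ(τ X)`.
* `FactorRep.E_apply_eq_zero`, `FactorRep.E_diag_apply` — a highest weight vector `v` of weight `l`
  satisfies `Ψ_τ(E_{jk}) v = 0` (`j < k`) and `Ψ_τ(E_{jj}) v = l_{τ,j} v`.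
* `FactorRep.isHighestWeightVector_of` — the converse.
* `FactorRep.isHighestWeightVector_pow` — `F^m v` is a highest weight vector of weight
  `s_α · l = l - m α` if it is nonzero (`m = l_{τ,i} - l_{τ,i+1} + 1`).
* `Literature.NumberTheory.Automorphic.HCWt.shiftWt_add_rho` — `(s_α · l) + ρ = s_α (l + ρ)` in coordinates.
* `FactorRep.E_lift_center` — `Ψ_τ(E_{jk})` commutes with `Z(𝔤)`.

## References

* `Literature.NumberTheory.Automorphic.HighestWeightGL` (this tree) — `IsHighestWeightVectorC`.
* A. W. Knapp, *Lie Groups Beyond an Introduction*, 2nd ed., Birkhäuser 2002, §V.3, §V.5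
  (Thm. 5.44), §VI.1.
* J. E. Humphreys, *Introduction to Lie Algebras and Representation Theory*, GTM 9, Springer 1972,
  §21.2 (Lemma), §23.2 (Proposition, Corollary, Corollary').
-/

attribute [local instance 100] LieRing.ofAssociativeRing

open scoped Matrix ComplexConjugate

noncomputable section

namespace Literature.NumberTheory.Automorphic.HCWt

open HCProj HCEmb RCLike

variable {𝕜 : Type*} [RCLike 𝕜] {n : ℕ}
variable {V : Type*} [AddCommGroup V] [Module ℂ V]

variable (𝕜 n V) in
/-- A **factorwise representation** of the complexification `𝔤_ℂ = ∏_{τ : 𝕜 →ₐ[ℝ] ℂ} 𝔤𝔩ₙ(ℂ)` of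
`𝔤𝔩ₙ(𝕜)` on a complex vector space `V`: complex Lie algebra homomorphisms
`Ψ_τ : 𝔤𝔩ₙ(ℂ) → End_ℂ V` whose images commute for `τ ≠ τ'`. Knapp, §VI.1 (complexification of a
real form) with §I.1 (direct sums of Lie algebras). [folklore] -/
structure FactorRep where
  /-- the representation of the `τ`-th factor `𝔤𝔩ₙ(ℂ)` -/
  toFun : (𝕜 →ₐ[ℝ] ℂ) → (Matrix (Fin n) (Fin n) ℂ →ₗ⁅ℂ⁆ Module.End ℂ V)
  /-- different factors commute -/
  commute : ∀ τ τ', τ ≠ τ' → ∀ X Y, toFun τ X * toFun τ' Y = toFun τ' Y * toFun τ X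

namespace FactorRep

variable (Ψ : FactorRep 𝕜 n V)

/-- The matrix unit `E_{jk}` of the `τ`-th factor, acting on `V`: `E Ψ τ j k = Ψ_τ(E_{jk})`.
[folklore] -/
def E (τ : 𝕜 →ₐ[ℝ] ℂ) (j k : Fin n) : Module.End ℂ V := Ψ.toFun τ (Matrix.single j k 1)

/-- `Ψ_τ(Y) = ∑_{j,k} Y_{jk} Ψ_τ(E_{jk})`. [folklore] -/
theorem apply_eq_sum (τ : 𝕜 →ₐ[ℝ] ℂ) (Y : Matrix (Fin n) (Fin n) ℂ) :
    Ψ.toFun τ Y = ∑ j, ∑ k, Y j k • Ψ.E τ j k := by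
  conv_lhs => rw [Matrix.matrix_eq_sum_single Y]
  simp only [map_sum]
  refine Finset.sum_congr rfl fun j _ ↦ Finset.sum_congr rfl fun k _ ↦ ?_
  rw [E, ← map_smul, Matrix.smul_single, smul_eq_mul, mul_one]

/-- Commutation relations of the matrix units inside one factor:
`[E_{jk}, E_{pq}] = δ_{kp} E_{jq} - δ_{qj} E_{pk}`. [folklore] -/
theorem E_mul_E_sub (τ : 𝕜 →ₐ[ℝ] ℂ) (j k p q : Fin n) :
    Ψ.E τ j k * Ψ.E τ p q - Ψ.E τ p q * Ψ.E τ j k =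
      (if k = p then Ψ.E τ j q else 0) - (if q = j then Ψ.E τ p k else 0) := by
  rw [← Ring.lie_def, E, E, ← LieHom.map_lie, HCSpan.single_lie_single, map_sub]
  congr 1
  · split_ifs <;> simp [E]
  · split_ifs <;> simp [E]

/-- Matrix units of different factors commute. [folklore] -/
theorem E_mul_E_of_ne {τ τ' : 𝕜 →ₐ[ℝ] ℂ} (h : τ ≠ τ') (j k p q : Fin n) :
    Ψ.E τ j k * Ψ.E τ' p q = Ψ.E τ' p q * Ψ.E τ j k :=
  Ψ.commute τ τ' h _ _

/-! ### The real form -/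

/-- `Ψ_τ` is real-linear. [folklore] -/
theorem map_real_smul (τ : 𝕜 →ₐ[ℝ] ℂ) (r : ℝ) (Y : Matrix (Fin n) (Fin n) ℂ) :
    Ψ.toFun τ (r • Y) = r • Ψ.toFun τ Y := by
  rw [← algebraMap_smul ℂ r Y, map_smul, algebraMap_smul]

/-- The **real form** of a factorwise representation: the real Lie algebra homomorphism
`ρ : 𝔤𝔩ₙ(𝕜) → End_ℂ V`, `ρ(X) = ∑_τ Ψ_τ(τ(X))` (restriction of `Ψ` along
`𝔤 ↪ 𝔤_ℂ = ∏_τ 𝔤𝔩ₙ(ℂ)`, `X ↦ (τ X)_τ`). Knapp, §VI.1. [folklore] -/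
def rho : Matrix (Fin n) (Fin n) 𝕜 →ₗ⁅ℝ⁆ Module.End ℂ V where
  toFun X := ∑ τ : 𝕜 →ₐ[ℝ] ℂ, Ψ.toFun τ (τ.mapMatrix X)
  map_add' X Y := by simp only [map_add, Finset.sum_add_distrib]
  map_smul' r X := by
    simp only [map_smul, RingHom.id_apply, Finset.smul_sum, map_real_smul]
  map_lie' {X Y} := by
    have h1 : ∀ τ : 𝕜 →ₐ[ℝ] ℂ, τ.mapMatrix ⁅X, Y⁆ = ⁅τ.mapMatrix X, τ.mapMatrix Y⁆ := fun τ ↦ by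
      rw [Ring.lie_def, Ring.lie_def, map_sub, map_mul, map_mul]
    simp only [h1, LieHom.map_lie]
    rw [lie_sum]
    refine Finset.sum_congr rfl fun τ _ ↦ ?_
    rw [sum_lie, Finset.sum_eq_single τ]
    · intro τ' _ hne
      rw [Ring.lie_def, Ψ.commute τ' τ hne, sub_self]
    · intro h; exact absurd (Finset.mem_univ τ) h

/-- Unfolding `rho`. [folklore] -/
theorem rho_apply (X : Matrix (Fin n) (Fin n) 𝕜) :
    Ψ.rho X = ∑ τ : 𝕜 →ₐ[ℝ] ℂ, Ψ.toFun τ (τ.mapMatrix X) := rfl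

/-- `ρ(X) = ∑_{τ,j,k} τ(X_{jk}) Ψ_τ(E_{jk})`. [folklore] -/
theorem rho_apply_eq_sum (X : Matrix (Fin n) (Fin n) 𝕜) :
    Ψ.rho X = ∑ τ : 𝕜 →ₐ[ℝ] ℂ, ∑ j, ∑ k, τ (X j k) • Ψ.E τ j k := by
  rw [rho_apply]
  refine Finset.sum_congr rfl fun τ _ ↦ ?_
  rw [apply_eq_sum]
  rfl

/-- `τ(I • X) = τ(I) • τ(X)` for matrices. [folklore] -/
theorem mapMatrix_I_smul (τ : 𝕜 →ₐ[ℝ] ℂ) (X : Matrix (Fin n) (Fin n) 𝕜) :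
    τ.mapMatrix ((I : 𝕜) • X) = τ I • τ.mapMatrix X := by
  ext j k
  simp [Matrix.map_apply]

/-- **The `τ`-projector of the real form is the `τ`-th factor**: `proj ρ τ X = Ψ_τ(τ X)`
(applied to any vector `w`). Knapp, §VI.1. [folklore] -/
theorem proj_rho (w : V) (τ : 𝕜 →ₐ[ℝ] ℂ) (X : Matrix (Fin n) (Fin n) 𝕜) :
    proj (fun Y ↦ Ψ.rho Y w) τ X = Ψ.toFun τ (τ.mapMatrix X) w := by
  rw [proj_def, ← orthogonality_sum (fun τ' ↦ Ψ.toFun τ' (τ'.mapMatrix X) w) τ]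
  congr 1
  rw [rho_apply, rho_apply]
  simp only [mapMatrix_I_smul, map_smul, LinearMap.sum_apply, LinearMap.smul_apply,
    Finset.smul_sum, ← Finset.sum_add_distrib]
  refine Finset.sum_congr rfl fun τ' _ ↦ ?_
  rw [add_smul, one_smul, smul_smul]

/-- `τ.mapMatrix (single j k b) = single j k (τ b)`. [folklore] -/
theorem mapMatrix_single (τ : 𝕜 →ₐ[ℝ] ℂ) (j k : Fin n) (b : 𝕜) :
    τ.mapMatrix (Matrix.single j k b) = Matrix.single j k (τ b) := by
  ext p q
  simp only [AlgHom.mapMatrix_apply, Matrix.map_apply, Matrix.single_apply]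
  split_ifs <;> simp

/-- `E_{τ,j,k} w` as a `τ`-projector of the real form. [folklore] -/
theorem E_apply_eq_proj (w : V) (τ : 𝕜 →ₐ[ℝ] ℂ) (j k : Fin n) :
    Ψ.E τ j k w = proj (fun Y ↦ Ψ.rho Y w) τ (Matrix.single j k (1 : 𝕜)) := by
  rw [proj_rho, mapMatrix_single, map_one, E]

section HW

variable {l : ArchWeightGL 𝕜 n} {v : V}

/-- A highest weight vector is killed by the raising matrix units of every factor:
`Ψ_τ(E_{jk}) v = 0` for `j < k`. Knapp, §V.5 and §VI.1. [folklore] -/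
theorem E_apply_eq_zero (hv : IsHighestWeightVector Ψ.rho l v) (τ : 𝕜 →ₐ[ℝ] ℂ) {j k : Fin n}
    (hjk : j < k) : Ψ.E τ j k v = 0 := by
  rw [E_apply_eq_proj, proj_def, Matrix.smul_single, smul_eq_mul, mul_one,
    hv.2.1 _ (single_mem_upperNilpLie hjk _), hv.2.1 _ (single_mem_upperNilpLie hjk _),
    smul_zero, add_zero, smul_zero]

/-- The value of a weight on `c E_{jj}`: `weightFun l (Pi.single j c) = ∑_τ l_{τ,j} τ(c)`.
[folklore] -/
theorem weightFun_single (l : ArchWeightGL 𝕜 n) (j : Fin n) (c : 𝕜) :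
    weightFun l (Pi.single j c) = ∑ τ : 𝕜 →ₐ[ℝ] ℂ, l τ j * τ c := by
  have h := aeval_letterPoly l (j, c)
  simp only [letterPoly, map_sum, map_mul, MvPolynomial.aeval_C, MvPolynomial.aeval_X,
    Algebra.algebraMap_self, RingHom.id_apply] at h
  rw [← h]
  exact Finset.sum_congr rfl fun τ _ ↦ mul_comm _ _

/-- A highest weight vector of weight `l` is a weight vector for the diagonal matrix units of
every factor: `Ψ_τ(E_{jj}) v = l_{τ,j} v`. Knapp, §V.5 and §VI.1. [folklore] -/
theorem E_diag_apply (hv : IsHighestWeightVector Ψ.rho l v) (τ : 𝕜 →ₐ[ℝ] ℂ) (j : Fin n) :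
    Ψ.E τ j j v = l τ j • v := by
  rw [E_apply_eq_proj, proj_def, Matrix.smul_single, smul_eq_mul, mul_one,
    ← Matrix.diagonal_single, ← Matrix.diagonal_single, hv.2.2, hv.2.2, weightFun_single,
    weightFun_single, ← orthogonality_sum (fun τ' ↦ l τ' j • v) τ]
  congr 1
  simp only [map_one, mul_one, Finset.sum_smul, Finset.smul_sum, ← Finset.sum_add_distrib]
  refine Finset.sum_congr rfl fun τ' _ ↦ ?_
  rw [smul_smul, smul_smul, ← add_smul]
  ring_nf

/-- Conversely, a nonzero common eigenvector of the `Ψ_τ(E_{jj})` killed by the `Ψ_τ(E_{jk})`,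
`j < k`, is a highest weight vector for the real form. Knapp, §V.5 and §VI.1. [folklore] -/
theorem isHighestWeightVector_of {w : V} (h0 : w ≠ 0)
    (hE : ∀ (τ : 𝕜 →ₐ[ℝ] ℂ) (j k : Fin n), j < k → Ψ.E τ j k w = 0)
    (hD : ∀ (τ : 𝕜 →ₐ[ℝ] ℂ) (j : Fin n), Ψ.E τ j j w = l τ j • w) :
    IsHighestWeightVector Ψ.rho l w := by
  refine ⟨h0, fun X hX ↦ ?_, fun h ↦ ?_⟩
  · rw [rho_apply_eq_sum, LinearMap.sum_apply]
    refine Finset.sum_eq_zero fun τ _ ↦ ?_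
    rw [LinearMap.sum_apply]
    refine Finset.sum_eq_zero fun j _ ↦ ?_
    rw [LinearMap.sum_apply]
    refine Finset.sum_eq_zero fun k _ ↦ ?_
    rw [LinearMap.smul_apply]
    rcases lt_or_ge j k with hjk | hkj
    · rw [hE τ j k hjk, smul_zero]
    · rw [(mem_upperNilpLie_iff 𝕜 n X).mp hX j k hkj, map_zero, zero_smul]
  · rw [rho_apply_eq_sum, LinearMap.sum_apply, weightFun, Finset.sum_smul]
    refine Finset.sum_congr rfl fun τ _ ↦ ?_
    rw [LinearMap.sum_apply, Finset.sum_smul]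
    refine Finset.sum_congr rfl fun j _ ↦ ?_
    rw [LinearMap.sum_apply, Finset.sum_eq_single j]
    · rw [LinearMap.smul_apply, Matrix.diagonal_apply_eq, hD, smul_smul, mul_comm]
    · intro k _ hkj
      rw [LinearMap.smul_apply, Matrix.diagonal_apply_ne _ (Ne.symm hkj), map_zero, zero_smul]
    · intro h; exact absurd (Finset.mem_univ j) h

end HW

/-! ### Bridge to representations of the product Lie algebra `𝔤𝔩ₙ(ℂ)^T` (`HighestWeightGL`) -/

/-- A factorwise representation as ONE complex Lie algebra homomorphism out of the product Lie
algebra `𝔤_ℂ = (T → 𝔤𝔩ₙ(ℂ))` (commutator bracket): `X ↦ ∑_τ Ψ_τ(X_τ)`. This is the encoding used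
by `HighestWeightGL` (`IsHighestWeightVectorC`). Knapp, §VI.1; Humphreys §1.2. [folklore] -/
def toLieHom : ((𝕜 →ₐ[ℝ] ℂ) → Matrix (Fin n) (Fin n) ℂ) →ₗ⁅ℂ⁆ Module.End ℂ V where
  toFun X := ∑ τ : 𝕜 →ₐ[ℝ] ℂ, Ψ.toFun τ (X τ)
  map_add' X Y := by simp only [Pi.add_apply, map_add, Finset.sum_add_distrib]
  map_smul' c X := by simp only [Pi.smul_apply, map_smul, RingHom.id_apply, Finset.smul_sum]
  map_lie' {X Y} := by
    have h1 : ∀ τ : 𝕜 →ₐ[ℝ] ℂ,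
        (⁅X, Y⁆ : (𝕜 →ₐ[ℝ] ℂ) → Matrix (Fin n) (Fin n) ℂ) τ = ⁅X τ, Y τ⁆ := fun τ ↦ by
      rw [Ring.lie_def, Ring.lie_def]
      rfl
    simp only [h1, LieHom.map_lie]
    rw [lie_sum]
    refine Finset.sum_congr rfl fun τ _ ↦ ?_
    rw [sum_lie, Finset.sum_eq_single τ]
    · intro τ' _ hne
      rw [Ring.lie_def, Ψ.commute τ' τ hne, sub_self]
    · intro h; exact absurd (Finset.mem_univ τ) h

/-- Unfolding `toLieHom`. [folklore] -/
theorem toLieHom_apply (X : (𝕜 →ₐ[ℝ] ℂ) → Matrix (Fin n) (Fin n) ℂ) :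
    Ψ.toLieHom X = ∑ τ : 𝕜 →ₐ[ℝ] ℂ, Ψ.toFun τ (X τ) := rfl

open scoped Classical in
/-- `toLieHom` on a tuple supported at one factor. [folklore] -/
theorem toLieHom_single (τ : 𝕜 →ₐ[ℝ] ℂ) (Y : Matrix (Fin n) (Fin n) ℂ) :
    Ψ.toLieHom (Pi.single (M := fun _ : 𝕜 →ₐ[ℝ] ℂ ↦ Matrix (Fin n) (Fin n) ℂ) τ Y) =
      Ψ.toFun τ Y := by
  rw [toLieHom_apply, Finset.sum_eq_single τ]
  · rw [Pi.single_eq_same]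
  · intro τ' _ h
    rw [Pi.single_eq_of_ne h, map_zero]
  · intro h; exact absurd (Finset.mem_univ τ) h

/-- The real form is `toLieHom` restricted along `𝔤 ↪ 𝔤_ℂ`, `X ↦ (τ X)_τ`. [folklore] -/
theorem rho_eq_toLieHom (X : Matrix (Fin n) (Fin n) 𝕜) :
    Ψ.rho X = Ψ.toLieHom fun τ ↦ τ.mapMatrix X := rfl

open scoped Classical in
/-- The inclusion of the `τ`-th factor `𝔤𝔩ₙ(ℂ) → (T → 𝔤𝔩ₙ(ℂ))` as a Lie algebra homomorphism
(commutator brackets). [folklore] -/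
def singleLieHom (τ : 𝕜 →ₐ[ℝ] ℂ) :
    Matrix (Fin n) (Fin n) ℂ →ₗ⁅ℂ⁆ ((𝕜 →ₐ[ℝ] ℂ) → Matrix (Fin n) (Fin n) ℂ) where
  toFun Y := Pi.single (M := fun _ : 𝕜 →ₐ[ℝ] ℂ ↦ Matrix (Fin n) (Fin n) ℂ) τ Y
  map_add' X Y := by
    show Pi.single (M := fun _ : 𝕜 →ₐ[ℝ] ℂ ↦ Matrix (Fin n) (Fin n) ℂ) τ (X + Y) =
      Pi.single (M := fun _ : 𝕜 →ₐ[ℝ] ℂ ↦ Matrix (Fin n) (Fin n) ℂ) τ X +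
        Pi.single (M := fun _ : 𝕜 →ₐ[ℝ] ℂ ↦ Matrix (Fin n) (Fin n) ℂ) τ Y
    exact Pi.single_add (f := fun _ : 𝕜 →ₐ[ℝ] ℂ ↦ Matrix (Fin n) (Fin n) ℂ) τ X Y
  map_smul' c X := by
    show Pi.single (M := fun _ : 𝕜 →ₐ[ℝ] ℂ ↦ Matrix (Fin n) (Fin n) ℂ) τ (c • X) =
      c • Pi.single (M := fun _ : 𝕜 →ₐ[ℝ] ℂ ↦ Matrix (Fin n) (Fin n) ℂ) τ X
    exact Pi.single_smul' τ c X
  map_lie' {X Y} := by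
    show Pi.single (M := fun _ : 𝕜 →ₐ[ℝ] ℂ ↦ Matrix (Fin n) (Fin n) ℂ) τ ⁅X, Y⁆ =
      ⁅Pi.single (M := fun _ : 𝕜 →ₐ[ℝ] ℂ ↦ Matrix (Fin n) (Fin n) ℂ) τ X,
        Pi.single (M := fun _ : 𝕜 →ₐ[ℝ] ℂ ↦ Matrix (Fin n) (Fin n) ℂ) τ Y⁆
    rw [Ring.lie_def, Ring.lie_def, Pi.single_sub, Pi.single_mul, Pi.single_mul]

open scoped Classical in
/-- Unfolding `singleLieHom`. [folklore] -/
theorem singleLieHom_apply (τ : 𝕜 →ₐ[ℝ] ℂ) (Y : Matrix (Fin n) (Fin n) ℂ) :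
    singleLieHom (𝕜 := 𝕜) τ Y = Pi.single (M := fun _ : 𝕜 →ₐ[ℝ] ℂ ↦ Matrix (Fin n) (Fin n) ℂ) τ Y :=
  rfl

open scoped Classical in
/-- Tuples supported at different factors have vanishing products. [folklore] -/
theorem single_mul_single_of_ne {τ τ' : 𝕜 →ₐ[ℝ] ℂ} (h : τ ≠ τ')
    (X Y : Matrix (Fin n) (Fin n) ℂ) :
    Pi.single (M := fun _ : 𝕜 →ₐ[ℝ] ℂ ↦ Matrix (Fin n) (Fin n) ℂ) τ X *
      Pi.single (M := fun _ : 𝕜 →ₐ[ℝ] ℂ ↦ Matrix (Fin n) (Fin n) ℂ) τ' Y = 0 := by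
  funext κ
  rw [Pi.mul_apply, Pi.zero_apply]
  by_cases hκ : κ = τ
  · subst hκ
    rw [Pi.single_eq_of_ne h, mul_zero]
  · rw [Pi.single_eq_of_ne hκ, zero_mul]

/-- Conversely, a complex Lie algebra homomorphism out of the product `(T → 𝔤𝔩ₙ(ℂ))` (the encoding
of `HighestWeightGL`) is a factorwise representation: `Ψ_τ = ρC ∘ single τ`. [folklore] -/
def ofLieHom (ρC : ((𝕜 →ₐ[ℝ] ℂ) → Matrix (Fin n) (Fin n) ℂ) →ₗ⁅ℂ⁆ Module.End ℂ V) :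
    FactorRep 𝕜 n V where
  toFun τ := ρC.comp (singleLieHom τ)
  commute τ τ' hne X Y := by
    classical
    have key : ρC (singleLieHom τ X) * ρC (singleLieHom τ' Y) -
        ρC (singleLieHom τ' Y) * ρC (singleLieHom τ X) = 0 := by
      simp only [singleLieHom_apply]
      rw [← Ring.lie_def, ← LieHom.map_lie, Ring.lie_def, single_mul_single_of_ne hne,
        single_mul_single_of_ne (Ne.symm hne), sub_zero, map_zero]
    exact sub_eq_zero.mp key

/-- Unfolding `ofLieHom`. [folklore] -/
theorem ofLieHom_toFun_apply (ρC : ((𝕜 →ₐ[ℝ] ℂ) → Matrix (Fin n) (Fin n) ℂ) →ₗ⁅ℂ⁆ Module.End ℂ V)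
    (τ : 𝕜 →ₐ[ℝ] ℂ) (Y : Matrix (Fin n) (Fin n) ℂ) :
    (ofLieHom ρC).toFun τ Y = ρC (singleLieHom τ Y) := rfl

/-- **The two highest weight predicates agree**: `v` is a highest weight vector of weight `l` for
`Ψ.toLieHom : (T → 𝔤𝔩ₙ(ℂ)) → End V` in the sense of `IsHighestWeightVectorC` (`HighestWeightGL`)
iff it is one for the real form `Ψ.rho : 𝔤𝔩ₙ(𝕜) → End V` in the sense of `IsHighestWeightVector`
(`HarishChandraGL`). Knapp, §VI.1 (weights of a real form vs. its complexification). [folklore] -/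
theorem isHighestWeightVectorC_iff {l : ArchWeightGL 𝕜 n} {v : V} :
    IsHighestWeightVectorC Ψ.toLieHom l v ↔ IsHighestWeightVector Ψ.rho l v := by
  classical
  constructor
  · intro h
    refine Ψ.isHighestWeightVector_of h.1 (fun τ j k hjk ↦ ?_) (fun τ j ↦ ?_)
    · rw [E, ← toLieHom_single]
      refine h.2.1 _ fun τ' a b hba ↦ ?_
      rw [Pi.single_apply]
      split_ifs
      · rw [Matrix.single_apply, if_neg]
        rintro ⟨rfl, rfl⟩
        exact absurd hjk (not_lt.mpr hba)
      · rfl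
    · rw [E, ← toLieHom_single, ← Matrix.diagonal_single]
      have e1 : Pi.single (M := fun _ : 𝕜 →ₐ[ℝ] ℂ ↦ Matrix (Fin n) (Fin n) ℂ) τ
          (Matrix.diagonal (Pi.single j (1 : ℂ))) =
          fun τ' ↦ Matrix.diagonal
            (Pi.single (M := fun _ : 𝕜 →ₐ[ℝ] ℂ ↦ Fin n → ℂ) τ (Pi.single j (1 : ℂ)) τ') := by
        funext τ'
        by_cases h' : τ' = τ
        · subst h'; rw [Pi.single_eq_same, Pi.single_eq_same]
        · rw [Pi.single_eq_of_ne h', Pi.single_eq_of_ne h']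
          simp
      rw [e1, h.2.2]
      congr 1
      rw [Finset.sum_eq_single τ, Finset.sum_eq_single j, Pi.single_eq_same, Pi.single_eq_same,
        mul_one]
      · intro i _ hij
        rw [Pi.single_eq_same, Pi.single_eq_of_ne hij, mul_zero]
      · intro h'; exact absurd (Finset.mem_univ j) h'
      · intro τ' _ hτ'
        exact Finset.sum_eq_zero fun i _ ↦ by rw [Pi.single_eq_of_ne hτ', Pi.zero_apply, mul_zero]
      · intro h'; exact absurd (Finset.mem_univ τ) h'
  · intro hv
    refine ⟨hv.1, fun X hX ↦ ?_, fun h ↦ ?_⟩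
    · rw [toLieHom_apply, LinearMap.sum_apply]
      refine Finset.sum_eq_zero fun τ _ ↦ ?_
      rw [apply_eq_sum, LinearMap.sum_apply]
      refine Finset.sum_eq_zero fun j _ ↦ ?_
      rw [LinearMap.sum_apply]
      refine Finset.sum_eq_zero fun k _ ↦ ?_
      rw [LinearMap.smul_apply]
      rcases lt_or_ge j k with hjk | hkj
      · rw [Ψ.E_apply_eq_zero hv τ hjk, smul_zero]
      · rw [hX τ j k hkj, zero_smul]
    · rw [toLieHom_apply, LinearMap.sum_apply, Finset.sum_smul]
      refine Finset.sum_congr rfl fun τ _ ↦ ?_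
      rw [apply_eq_sum, LinearMap.sum_apply, Finset.sum_smul]
      refine Finset.sum_congr rfl fun j _ ↦ ?_
      rw [LinearMap.sum_apply, Finset.sum_eq_single j]
      · rw [LinearMap.smul_apply, Matrix.diagonal_apply_eq, Ψ.E_diag_apply hv, smul_smul, mul_comm]
      · intro k _ hkj
        rw [LinearMap.smul_apply, Matrix.diagonal_apply_ne _ (Ne.symm hkj), zero_smul]
      · intro h'; exact absurd (Finset.mem_univ j) h'

/-- The matrix units `Ψ_τ(E_{jk})` commute with the action of the centre `Z(𝔤)` of the real
enveloping algebra (they are complex linear combinations of `ρ(E_{jk})`, `ρ(I E_{jk})`).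
Knapp, §V.5. [folklore] -/
theorem E_lift_center {z : HCSpan.UGL 𝕜 n} (hz : z ∈ Subalgebra.center ℝ (HCSpan.UGL 𝕜 n))
    (τ : 𝕜 →ₐ[ℝ] ℂ) (j k : Fin n) (w : V) :
    Ψ.E τ j k (UniversalEnvelopingAlgebra.lift ℝ Ψ.rho z w) =
      UniversalEnvelopingAlgebra.lift ℝ Ψ.rho z (Ψ.E τ j k w) := by
  have key : ∀ (a b : V) (c d : ℂ), UniversalEnvelopingAlgebra.lift ℝ Ψ.rho z (d • (a + c • b)) =
      d • (UniversalEnvelopingAlgebra.lift ℝ Ψ.rho z a +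
        c • UniversalEnvelopingAlgebra.lift ℝ Ψ.rho z b) := by
    intro a b c d
    rw [map_smul, map_add, map_smul]
  rw [E_apply_eq_proj, E_apply_eq_proj, proj_def, proj_def, rho_lift_center_apply _ hz,
    rho_lift_center_apply _ hz, key]

/-- Powers of `Ψ_τ(E_{jk})` commute with the action of the centre. [folklore] -/
theorem E_pow_lift_center {z : HCSpan.UGL 𝕜 n} (hz : z ∈ Subalgebra.center ℝ (HCSpan.UGL 𝕜 n))
    (τ : 𝕜 →ₐ[ℝ] ℂ) (j k : Fin n) (m : ℕ) (w : V) :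
    (Ψ.E τ j k ^ m) (UniversalEnvelopingAlgebra.lift ℝ Ψ.rho z w) =
      UniversalEnvelopingAlgebra.lift ℝ Ψ.rho z ((Ψ.E τ j k ^ m) w) := by
  induction m with
  | zero => simp
  | succ m ih => rw [pow_succ', Module.End.mul_apply, ih, E_lift_center _ hz, Module.End.mul_apply]

end FactorRep

/-! ### The `𝔰𝔩₂`-string through a highest weight vector -/

open scoped Classical in
/-- The weight with coordinates `l_{τ,i} - c`, `l_{τ,i'} + c` and all others unchanged; for
`i ≠ i'` this is `l - c • α` for the root `α = e_{τ,i} - e_{τ,i'}` of the factor `τ`. For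
`i' = i + 1` and `c = l_{τ,i} - l_{τ,i+1} + 1` this is `s_α(l + ρ) - ρ`. Humphreys, §23.2
(Corollary). [folklore] -/
def shiftWt (l : ArchWeightGL 𝕜 n) (τ : 𝕜 →ₐ[ℝ] ℂ) (i i' : Fin n) (c : ℂ) : ArchWeightGL 𝕜 n :=
  fun τ' j ↦ l τ' j - if τ' = τ then (if j = i then c else if j = i' then -c else 0) else 0

section String

variable {l : ArchWeightGL 𝕜 n} {τ : 𝕜 →ₐ[ℝ] ℂ} {i i' : Fin n}

/-- `shiftWt l τ i i' 0 = l`. [folklore] -/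
@[simp] theorem shiftWt_zero (l : ArchWeightGL 𝕜 n) (τ : 𝕜 →ₐ[ℝ] ℂ) (i i' : Fin n) :
    shiftWt l τ i i' 0 = l := by
  funext τ' j
  simp only [shiftWt]
  split_ifs <;> simp

/-- Away from the factor `τ` the weight is unchanged. [folklore] -/
theorem shiftWt_of_ne (l : ArchWeightGL 𝕜 n) {τ τ' : 𝕜 →ₐ[ℝ] ℂ} (h : τ' ≠ τ) (i i' : Fin n)
    (c : ℂ) (j : Fin n) : shiftWt l τ i i' c τ' j = l τ' j := by
  classical
  simp [shiftWt, h]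

/-- The `i`-th coordinate in the factor `τ`. [folklore] -/
theorem shiftWt_self_left (l : ArchWeightGL 𝕜 n) (τ : 𝕜 →ₐ[ℝ] ℂ) (i i' : Fin n) (c : ℂ) :
    shiftWt l τ i i' c τ i = l τ i - c := by
  classical
  simp [shiftWt]

/-- The `i'`-th coordinate in the factor `τ` (`i' ≠ i`). [folklore] -/
theorem shiftWt_self_right (l : ArchWeightGL 𝕜 n) (τ : 𝕜 →ₐ[ℝ] ℂ) {i i' : Fin n} (h : i' ≠ i)
    (c : ℂ) : shiftWt l τ i i' c τ i' = l τ i' + c := by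
  classical
  simp [shiftWt, h]

open scoped Classical in
/-- Recursion in `c`: `shiftWt l τ i i' (c + 1) = shiftWt l τ i i' c - α`. [folklore] -/
theorem shiftWt_add_one (l : ArchWeightGL 𝕜 n) (τ : 𝕜 →ₐ[ℝ] ℂ) (i i' : Fin n) (c : ℂ)
    (τ' : 𝕜 →ₐ[ℝ] ℂ) (j : Fin n) :
    shiftWt l τ i i' (c + 1) τ' j = shiftWt l τ i i' c τ' j -
      if τ' = τ then (if j = i then 1 else if j = i' then -1 else 0) else 0 := by
  classical
  simp only [shiftWt]
  split_ifs <;> ring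

namespace FactorRep

variable (Ψ : FactorRep 𝕜 n V) {v : V}

/-- Raising operators other than `E_α` kill the whole `F_α`-string through a highest weight vector
(`α = e_{τ,i} - e_{τ,i+1}` simple, `F_α = Ψ_τ(E_{i+1,i})`): for `j < k` with
`(τ', j, k) ≠ (τ, i, i+1)`, `Ψ_{τ'}(E_{jk}) F_α^m v = 0`. Humphreys, §21.2 Lemma (a) and §23.2
(proof of the Proposition). [folklore] -/
theorem E_pow_apply_eq_zero (hv : IsHighestWeightVector Ψ.rho l v) (hi : (i' : ℕ) = i + 1) :
    ∀ (m : ℕ) (τ' : 𝕜 →ₐ[ℝ] ℂ) (j k : Fin n), j < k → ¬(τ' = τ ∧ j = i ∧ k = i') →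
      Ψ.E τ' j k ((Ψ.E τ i' i ^ m) v) = 0 := by
  intro m
  induction m with
  | zero => intro τ' j k hjk _; simpa using Ψ.E_apply_eq_zero hv τ' hjk
  | succ m ih =>
    intro τ' j k hjk hne
    rw [pow_succ', Module.End.mul_apply, ← Module.End.mul_apply (f := Ψ.E τ' j k)]
    by_cases hτ : τ' = τ
    · subst hτ
      rw [← sub_add_cancel (Ψ.E τ' j k * Ψ.E τ' i' i) (Ψ.E τ' i' i * Ψ.E τ' j k), E_mul_E_sub,
        LinearMap.add_apply, Module.End.mul_apply, ih τ' j k hjk hne, map_zero, add_zero,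
        LinearMap.sub_apply]
      have h1 : (if k = i' then Ψ.E τ' j i else 0) ((Ψ.E τ' i' i ^ m) v) = 0 := by
        split_ifs with hk
        · subst hk
          have hji : j ≠ i := fun h ↦ hne ⟨rfl, h, rfl⟩
          have hji' : j < i := by
            rcases lt_or_ge j i with h | h
            · exact h
            · exfalso
              have h1 : (j : ℕ) < k := hjk
              have h2 : (i : ℕ) ≤ j := h
              exact hji (Fin.ext (by omega))
          exact ih τ' j i hji' (fun h ↦ absurd h.2.2 (fun h' ↦ by
            have := congrArg Fin.val h'; omega))
        · rfl
      have h2 : (if i = j then Ψ.E τ' i' k else 0) ((Ψ.E τ' i' i ^ m) v) = 0 := by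
        split_ifs with hij
        · subst hij
          have hki' : k ≠ i' := fun h ↦ hne ⟨rfl, rfl, h⟩
          have hlt : i' < k := by
            have h1 : (i : ℕ) < k := hjk
            have h2 : (k : ℕ) ≠ i' := fun h ↦ hki' (Fin.ext h)
            show (i' : ℕ) < k
            omega
          exact ih τ' i' k hlt (fun h ↦ absurd h.2.1 (fun h' ↦ by
            have := congrArg Fin.val h'; omega))
        · rfl
      rw [h1, h2, sub_zero]
    · rw [Ψ.E_mul_E_of_ne hτ, Module.End.mul_apply, ih τ' j k hjk hne, map_zero]

/-- Weights along the `F_α`-string (`α = e_{τ,i} - e_{τ,i'}` any root, `i' ≠ i`):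
`Ψ_{τ'}(E_{jj}) F_α^m v = (l - m α)_{τ',j} F_α^m v`. Humphreys, §21.2 Lemma (b); cf. Mathlib's
`IsSl2Triple.HasPrimitiveVectorWith.lie_h_pow_toEnd_f` (`Mathlib/Algebra/Lie/Sl2.lean`) for the
`𝔰𝔩₂`-triple itself. [folklore] -/
theorem E_diag_pow_apply (hv : IsHighestWeightVector Ψ.rho l v) (hii' : i' ≠ i) :
    ∀ (m : ℕ) (τ' : 𝕜 →ₐ[ℝ] ℂ) (j : Fin n),
      Ψ.E τ' j j ((Ψ.E τ i' i ^ m) v) = shiftWt l τ i i' m τ' j • (Ψ.E τ i' i ^ m) v := by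
  classical
  intro m
  induction m with
  | zero => intro τ' j; simpa using Ψ.E_diag_apply hv τ' j
  | succ m ih =>
    intro τ' j
    rw [pow_succ', Module.End.mul_apply, ← Module.End.mul_apply (f := Ψ.E τ' j j), Nat.cast_succ,
      shiftWt_add_one]
    by_cases hτ : τ' = τ
    · subst hτ
      rw [← sub_add_cancel (Ψ.E τ' j j * Ψ.E τ' i' i) (Ψ.E τ' i' i * Ψ.E τ' j j), E_mul_E_sub,
        LinearMap.add_apply, Module.End.mul_apply, ih τ' j, map_smul, LinearMap.sub_apply,
        if_pos rfl]
      by_cases hji : j = i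
      · subst hji
        rw [if_neg hii'.symm, if_pos rfl, if_pos rfl, LinearMap.zero_apply, zero_sub, sub_smul,
          one_smul]
        abel
      · rw [if_neg (Ne.symm hji), if_neg hji]
        by_cases hji' : j = i'
        · subst hji'
          rw [if_pos rfl, if_pos rfl, LinearMap.zero_apply, sub_zero, sub_neg_eq_add, add_smul,
            one_smul]
          abel
        · rw [if_neg hji', if_neg hji', sub_zero, LinearMap.zero_apply, sub_self, zero_add]
    · rw [Ψ.E_mul_E_of_ne hτ, Module.End.mul_apply, ih τ' j, map_smul, if_neg hτ, sub_zero]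

/-- The `𝔰𝔩₂`-string identity `E_α F_α^{m+1} v = (m+1)(⟨l, α^∨⟩ - m) F_α^m v` for a highest weight
vector `v` of weight `l` (`α = e_{τ,i} - e_{τ,i'}` any positive root, `i < i'`). Humphreys, §21.2
Lemma (c); cf. Mathlib's `IsSl2Triple.HasPrimitiveVectorWith.lie_e_pow_succ_toEnd_f`.
[folklore] -/
theorem E_pow_succ_apply (hv : IsHighestWeightVector Ψ.rho l v) (hlt : i < i') :
    ∀ m : ℕ, Ψ.E τ i i' ((Ψ.E τ i' i ^ (m + 1)) v) =
      ((m + 1 : ℂ) * (l τ i - l τ i' - m)) • (Ψ.E τ i' i ^ m) v := by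
  have hii' : i' ≠ i := ne_of_gt hlt
  have hH : ∀ m : ℕ, (Ψ.E τ i i' * Ψ.E τ i' i - Ψ.E τ i' i * Ψ.E τ i i') ((Ψ.E τ i' i ^ m) v) =
      (l τ i - l τ i' - 2 * m) • (Ψ.E τ i' i ^ m) v := by
    intro m
    rw [E_mul_E_sub, if_pos rfl, if_pos rfl, LinearMap.sub_apply, Ψ.E_diag_pow_apply hv hii',
      Ψ.E_diag_pow_apply hv hii', shiftWt_self_left, shiftWt_self_right _ _ hii', ← sub_smul]
    congr 1
    ring
  intro m
  induction m with
  | zero =>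
    rw [zero_add, pow_one, pow_zero, Module.End.one_apply, ← Module.End.mul_apply,
      ← sub_add_cancel (Ψ.E τ i i' * Ψ.E τ i' i) (Ψ.E τ i' i * Ψ.E τ i i'), LinearMap.add_apply,
      Module.End.mul_apply, Ψ.E_apply_eq_zero hv τ hlt, map_zero, add_zero]
    have := hH 0
    rw [pow_zero, Module.End.one_apply] at this
    rw [this]
    congr 1
    push_cast
    ring
  | succ m ih =>
    rw [pow_succ' _ (m + 1), Module.End.mul_apply, ← Module.End.mul_apply (f := Ψ.E τ i i'),
      ← sub_add_cancel (Ψ.E τ i i' * Ψ.E τ i' i) (Ψ.E τ i' i * Ψ.E τ i i'), LinearMap.add_apply,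
      Module.End.mul_apply, ih, map_smul, hH (m + 1), ← Module.End.mul_apply (f := Ψ.E τ i' i),
      ← pow_succ', ← add_smul]
    congr 1
    push_cast
    ring

/-- **Reflected highest weight vectors.** Let `v` be a highest weight vector of weight `l`,
`α = e_{τ,i} - e_{τ,i+1}` a simple root of the factor `τ`, `F_α = Ψ_τ(E_{i+1,i})`, and
`m = l_{τ,i} - l_{τ,i+1} + 1 = ⟨l + ρ, α^∨⟩ ∈ ℕ`. If `F_α^m v ≠ 0` then it is a highest weight
vector of weight `l - m α = s_α(l + ρ) - ρ`. Humphreys, GTM 9, §23.2, Proposition ("the coset of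
`y_α^{m+1}` in `Z(λ)` is a maximal vector of weight `λ - (m+1)α`", proved from the formulas of
Lemma 21.2) and its Corollary (`μ = σ_α(λ + δ) - δ`); Knapp, *Lie Groups Beyond an Introduction*,
§V.3 and the proof of Thm. 5.44. [cite: Humphreys1972, §23.2 Proposition and §21.2 Lemma] -/
theorem isHighestWeightVector_pow (hv : IsHighestWeightVector Ψ.rho l v) (hi : (i' : ℕ) = i + 1)
    {m : ℕ} (hm : (m : ℂ) = l τ i - l τ i' + 1) (hne : (Ψ.E τ i' i ^ m) v ≠ 0) :
    IsHighestWeightVector Ψ.rho (shiftWt l τ i i' m) ((Ψ.E τ i' i ^ m) v) := by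
  have hlt : i < i' := by show (i : ℕ) < i'; omega
  refine Ψ.isHighestWeightVector_of hne (fun τ' j k hjk ↦ ?_)
    (Ψ.E_diag_pow_apply hv (ne_of_gt hlt) m)
  by_cases h : τ' = τ ∧ j = i ∧ k = i'
  · obtain ⟨rfl, rfl, rfl⟩ := h
    cases m with
    | zero => simpa using Ψ.E_apply_eq_zero hv τ' hlt
    | succ m =>
      rw [Ψ.E_pow_succ_apply hv hlt m]
      have : (m + 1 : ℂ) * (l τ' j - l τ' k - m) = 0 := by
        push_cast at hm
        linear_combination (m + 1 : ℂ) * (-hm)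
      rw [this, zero_smul]
  · exact Ψ.E_pow_apply_eq_zero hv hi m τ' j k hjk h

end FactorRep

open scoped Classical in
/-- **`(s_α · l) + ρ = s_α (l + ρ)`**: for `m = l_{τ,i} - l_{τ,i+1} + 1` the point
`shiftWt l τ i (i+1) m + ρ ∈ 𝔥_ℂ^*` is obtained from `l + ρ` by the transposition `(i, i+1)` in
the factor `τ`. Humphreys, §23.2, proof of the Corollary (`σ_α δ - δ = -α`). [folklore] -/
theorem shiftWt_add_rho (l : ArchWeightGL 𝕜 n) (τ : 𝕜 →ₐ[ℝ] ℂ) {i i' : Fin n}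
    (hi : (i' : ℕ) = i + 1) {m : ℕ} (hm : (m : ℂ) = l τ i - l τ i' + 1) :
    (fun p : (𝕜 →ₐ[ℝ] ℂ) × Fin n ↦ shiftWt l τ i i' m p.1 p.2 + rhoGL n p.2) =
      (fun p : (𝕜 →ₐ[ℝ] ℂ) × Fin n ↦ l p.1 p.2 + rhoGL n p.2) ∘
        Equiv.prodCongrRight (Pi.mulSingle τ (Equiv.swap i i')) := by
  have hii' : i' ≠ i := fun h ↦ by have := congrArg Fin.val h; omega
  have hρ : rhoGL n i = rhoGL n i' + 1 := by
    simp only [rhoGL, hi]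
    push_cast
    ring
  funext ⟨τ', j⟩
  simp only [Function.comp_apply, Equiv.prodCongrRight_apply]
  by_cases hτ : τ' = τ
  · subst hτ
    rw [Pi.mulSingle_eq_same]
    by_cases hji : j = i
    · subst hji
      rw [Equiv.swap_apply_left, shiftWt_self_left, hρ, hm]
      ring
    · by_cases hji' : j = i'
      · subst hji'
        rw [Equiv.swap_apply_right, shiftWt_self_right _ _ hii', hρ, hm]
        ring
      · rw [Equiv.swap_apply_of_ne_of_ne hji hji']
        simp [shiftWt, hji, hji']
  · rw [Pi.mulSingle_eq_of_ne hτ, Equiv.Perm.coe_one, id, shiftWt_of_ne _ hτ]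

end String

end Literature.NumberTheory.Automorphic.HCWt
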